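import Mathlib
import Summits.AtomisticToContinuum.FouriersLaw.Theorems.EmbeddedDrudeMourreAbelOfSpectralDensity
import HarnessLib

/-!
# `MourreDissolution`, line `separable-vertex-faddeev-pair-sector` — stub `stub_poissonWindowInversion`

Item `stmt-AtomisticToContinuum-12594`, stub S3 (Poisson-window inversion; folklore, the Stieltjes–Perron /
Fatou inversion in weak form). For a finite measure `σ` with cosine transform `C`, if the Abel–Poisson
transforms `F_ν(ω) = ∫_{t>0} e^{-νt} cos(ωt) C(t) dt` converge uniformly on `[-δ, δ]` to a continuous
`h`, then `σ' := ½(σ + σ(-·))` is finite with cosine transform `C`, `h ≥ 0`, and `σ'|_(−δ,δ) = (h/π)dω`.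
1. `integral_exp_neg_mul_cos_mul_cosTransform`: `F_ν(ω) = ∫ ν/((x-ω)²+ν²) dσ'(x) ≥ 0` (product formula
   for cosines, the route's proved `integral_exp_neg_mul_cosTransform` on the shifted measures); so `h ≥ 0`.
2. `pi_mul_integral_eq_of_tendstoUniformlyOn`: `π ∫ φ dσ' = ∫ φ h` for `φ` continuous, compactly
   supported, vanishing off `[-δ, δ]` (Fubini, `Literature…tendsto_poisson_integral`, dominated
   convergence twice).
3. `restrict_Ioo_eq_withDensity_of_forall_integral`: with the cutoff `ρ = max(δ-|·|, 0)` the finite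
   measures `ρ dσ'` and `ρ h/π dω` agree on bounded continuous functions, hence coincide; divide by `ρ`.
-/


noncomputable section

open MeasureTheory Filter Set Topology
open scoped NNReal ENNReal

namespace Summit.AtomisticToContinuum.FouriersLaw.Theorems.MourreDissolution

open Summit.AtomisticToContinuum.FouriersLaw.Theorems.AbelOfSpectralDensity
  (integral_exp_neg_mul_cosTransform)
open Literature.Analysis.InverseSpectral (integral_poissonKernel integrable_poissonKernel
  poissonKernel_nonneg tendsto_poisson_integral continuous_poisson_integrand)

/-- A continuous function bounded in norm is integrable against a finite measure on `ℝ`.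
[folklore] -/
theorem integrable_of_continuous_of_norm_le (μ : Measure ℝ) [IsFiniteMeasure μ] {f : ℝ → ℝ}
    (hf : Continuous f) {M : ℝ} (hM : ∀ x, ‖f x‖ ≤ M) : Integrable f μ :=
  (integrable_const M).mono' hf.aestronglyMeasurable (ae_of_all _ hM)

/-- The Poisson-kernel bound `‖ν/(a²+ν²)‖ ≤ ν/ν²` for `ν > 0`. [folklore] -/
theorem norm_poisson_le {ν : ℝ} (hν : 0 < ν) (a : ℝ) : ‖ν / (a ^ 2 + ν ^ 2)‖ ≤ ν / ν ^ 2 := by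
  rw [Real.norm_of_nonneg (by positivity)]
  exact div_le_div_of_nonneg_left hν.le (by positivity) (by nlinarith [sq_nonneg a])

/-- The integral against the half-sum `½(μ₁ + μ₂)` of two measures. [folklore] -/
theorem integral_half_add {μ₁ μ₂ : Measure ℝ} {F : ℝ → ℝ} (h₁ : Integrable F μ₁)
    (h₂ : Integrable F μ₂) :
    ∫ x, F x ∂((2⁻¹ : ℝ≥0) • (μ₁ + μ₂)) = 2⁻¹ * (∫ x, F x ∂μ₁ + ∫ x, F x ∂μ₂) := by
  rw [integral_smul_nnreal_measure, integral_add_measure h₁ h₂, NNReal.smul_def, smul_eq_mul]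
  push_cast
  ring

/-- The integral of a bounded continuous function against the symmetrisation `½(σ + σ(-·))`.
[folklore] -/
theorem integral_symm (σ : Measure ℝ) [IsFiniteMeasure σ] {F : ℝ → ℝ} (hF : Continuous F) {M : ℝ}
    (hM : ∀ x, ‖F x‖ ≤ M) :
    ∫ x, F x ∂((2⁻¹ : ℝ≥0) • (σ + σ.map (fun x : ℝ => -x))) =
      2⁻¹ * (∫ x, F x ∂σ + ∫ x, F (-x) ∂σ) := by
  have hemb : MeasurableEmbedding (fun x : ℝ => -x) := (Homeomorph.neg ℝ).measurableEmbedding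
  rw [integral_half_add (integrable_of_continuous_of_norm_le σ hF hM)
    (integrable_of_continuous_of_norm_le _ hF hM), hemb.integral_map]

/-- A continuous cutoff of the window: `ρ ≥ 0`, bounded, positive exactly on `(-δ, δ)`. [folklore] -/
theorem exists_window_cutoff (δ : ℝ) :
    ∃ ρ : ℝ → ℝ, Continuous ρ ∧ (∀ x, 0 ≤ ρ x) ∧ (∀ x, ‖ρ x‖ ≤ |δ|) ∧
      (∀ x ∈ Ioo (-δ) δ, 0 < ρ x) ∧ (∀ x, x ∉ Ioo (-δ) δ → ρ x = 0) := by
  refine ⟨fun x => max (δ - |x|) 0, (continuous_const.sub continuous_abs).max continuous_const,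
    fun x => le_max_right _ _, fun x => ?_, fun x hx => ?_, fun x hx => ?_⟩
  · rw [Real.norm_of_nonneg (le_max_right _ _)]
    refine max_le ?_ (abs_nonneg δ)
    linarith [abs_nonneg x, le_abs_self δ]
  · rw [mem_Ioo, ← abs_lt] at hx
    exact lt_max_of_lt_left (by linarith)
  · rw [mem_Ioo, ← abs_lt, not_lt] at hx
    exact max_eq_right (by linarith)

/-- **Poisson representation.** For a finite measure `σ` with cosine transform `C`, `ν > 0` and
`ω ∈ ℝ`: `∫_{t>0} e^{-νt} cos(ωt) C(t) dt = ∫ ν/((x-ω)²+ν²) dσ'(x)` with `σ' = ½(σ + σ(-·))`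
(product formula for cosines, Fubini, `∫₀^∞ e^{-νt} cos(ut) dt = ν/(ν²+u²)`). [folklore] -/
theorem integral_exp_neg_mul_cos_mul_cosTransform (σ : Measure ℝ) [IsFiniteMeasure σ] {C : ℝ → ℝ}
    (hC : ∀ t : ℝ, C t = ∫ x, Real.cos (x * t) ∂σ) {ν : ℝ} (hν : 0 < ν) (ω : ℝ) :
    ∫ t in Ioi (0:ℝ), Real.exp (-(ν * t)) * Real.cos (ω * t) * C t =
      ∫ x, ν / ((x - ω) ^ 2 + ν ^ 2) ∂((2⁻¹ : ℝ≥0) • (σ + σ.map (fun x : ℝ => -x))) := by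
  have hsub : MeasurableEmbedding (fun x : ℝ => x - ω) := by
    simpa only [sub_eq_add_neg] using measurableEmbedding_addRight (-ω)
  have hadd : MeasurableEmbedding (fun x : ℝ => x + ω) := measurableEmbedding_addRight ω
  have hcos1 : ∀ a : ℝ, ‖Real.cos a‖ ≤ 1 := fun a => by
    rw [Real.norm_eq_abs]; exact Real.abs_cos_le_one a
  -- the shifted measure `τ = ½(σ(· + ω) + σ(· - ω))`
  obtain ⟨τ, hτ⟩ : ∃ τ : Measure ℝ,
      τ = (2⁻¹ : ℝ≥0) • (σ.map (fun x : ℝ => x - ω) + σ.map (fun x : ℝ => x + ω)) := ⟨_, rfl⟩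
  haveI : IsFiniteMeasure τ := by rw [hτ]; infer_instance
  -- pointwise: `cos(ωt) C(t) = ∫ cos(ut) dτ(u)`
  have hpt : ∀ t : ℝ, Real.cos (ω * t) * C t = ∫ u, Real.cos (u * t) ∂τ := by
    intro t
    have hi : ∀ (μ : Measure ℝ) [IsFiniteMeasure μ], Integrable (fun u => Real.cos (u * t)) μ :=
      fun μ _ => integrable_of_continuous_of_norm_le μ (by fun_prop) (fun u => hcos1 _)
    have h1 : Integrable (fun x => Real.cos ((x - ω) * t)) σ :=
      integrable_of_continuous_of_norm_le σ (by fun_prop) (fun x => hcos1 _)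
    have h2 : Integrable (fun x => Real.cos ((x + ω) * t)) σ :=
      integrable_of_continuous_of_norm_le σ (by fun_prop) (fun x => hcos1 _)
    rw [hτ, integral_half_add (hi _) (hi _), hsub.integral_map, hadd.integral_map, hC t,
      ← integral_const_mul, ← integral_add h1 h2, ← integral_const_mul]
    refine integral_congr_ae (ae_of_all _ (fun x => ?_))
    dsimp only
    rw [sub_mul, add_mul, Real.cos_sub, Real.cos_add]
    ring
  -- integrability of the Poisson kernels
  have hP : ∀ (μ : Measure ℝ) [IsFiniteMeasure μ], Integrable (fun u : ℝ => ν / (ν ^ 2 + u ^ 2)) μ :=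
    fun μ _ => integrable_of_continuous_of_norm_le μ
      (continuous_const.div (by fun_prop) (fun u => by positivity))
      (fun u => by rw [add_comm]; exact norm_poisson_le hν u)
  have hPc : Continuous (fun x : ℝ => ν / ((x - ω) ^ 2 + ν ^ 2)) :=
    continuous_const.div (by fun_prop) (fun u => by positivity)
  calc ∫ t in Ioi (0:ℝ), Real.exp (-(ν * t)) * Real.cos (ω * t) * C t
      = ∫ t in Ioi (0:ℝ), Real.exp (-(ν * t)) * ∫ u, Real.cos (u * t) ∂τ := by
        refine setIntegral_congr_fun measurableSet_Ioi (fun t _ => ?_)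
        rw [mul_assoc, hpt t]
    _ = ∫ u, ν / (ν ^ 2 + u ^ 2) ∂τ := integral_exp_neg_mul_cosTransform τ hν
    _ = 2⁻¹ * (∫ x, ν / (ν ^ 2 + (x - ω) ^ 2) ∂σ + ∫ x, ν / (ν ^ 2 + (x + ω) ^ 2) ∂σ) := by
        rw [hτ, integral_half_add (hP _) (hP _), hsub.integral_map, hadd.integral_map]
    _ = 2⁻¹ * (∫ x, ν / ((x - ω) ^ 2 + ν ^ 2) ∂σ + ∫ x, ν / ((-x - ω) ^ 2 + ν ^ 2) ∂σ) := by
        have e1 : ∫ x, ν / (ν ^ 2 + (x - ω) ^ 2) ∂σ = ∫ x, ν / ((x - ω) ^ 2 + ν ^ 2) ∂σ :=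
          integral_congr_ae (ae_of_all _ (fun x => by dsimp only; rw [add_comm]))
        have e2 : ∫ x, ν / (ν ^ 2 + (x + ω) ^ 2) ∂σ = ∫ x, ν / ((-x - ω) ^ 2 + ν ^ 2) ∂σ :=
          integral_congr_ae (ae_of_all _ (fun x => by ring))
        rw [e1, e2]
    _ = ∫ x, ν / ((x - ω) ^ 2 + ν ^ 2) ∂((2⁻¹ : ℝ≥0) • (σ + σ.map (fun x : ℝ => -x))) :=
        (integral_symm σ hPc (fun x => norm_poisson_le hν (x - ω))).symm

/-- **Weak inversion.** If `μ` is finite and the Poisson integrals `∫ ν/((x-ω)²+ν²) dμ(x)` converge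
to `h` uniformly on `[-δ, δ]` as `ν ↓ 0` (`h` continuous there), then `π ∫ φ dμ = ∫ φ h` for every
continuous compactly supported `φ` vanishing off `[-δ, δ]` (approximate identity + Fubini + dominated
convergence). [folklore] -/
theorem pi_mul_integral_eq_of_tendstoUniformlyOn (μ : Measure ℝ) [IsFiniteMeasure μ] {δ : ℝ}
    {h : ℝ → ℝ} (hh : ContinuousOn h (Icc (-δ) δ))
    (hunif : TendstoUniformlyOn (fun (ν : ℝ) (ω : ℝ) => ∫ x, ν / ((x - ω) ^ 2 + ν ^ 2) ∂μ) h
      (𝓝[>] 0) (Icc (-δ) δ))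
    {φ : ℝ → ℝ} (hφc : Continuous φ) (hφs : HasCompactSupport φ)
    (hφ0 : ∀ ω, ω ∉ Icc (-δ) δ → φ ω = 0) :
    Real.pi * ∫ x, φ x ∂μ = ∫ ω, φ ω * h ω := by
  obtain ⟨M, hM⟩ := hφs.exists_bound_of_continuous hφc
  have hM0 : 0 ≤ M := (norm_nonneg _).trans (hM 0)
  -- (a) the smoothed test function `g_ν(x) = ∫ ν/((x-ω)²+ν²) φ(ω) dω`: bound and measurability
  have hgb : ∀ ν : ℝ, 0 < ν → ∀ x : ℝ, ‖∫ ω, ν / ((x - ω) ^ 2 + ν ^ 2) * φ ω‖ ≤ Real.pi * M := by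
    intro ν hν x
    have hPint := integrable_poissonKernel hν x
    calc ‖∫ ω, ν / ((x - ω) ^ 2 + ν ^ 2) * φ ω‖ ≤ ∫ ω, ν / ((x - ω) ^ 2 + ν ^ 2) * M := by
          refine norm_integral_le_of_norm_le (hPint.mul_const M) (ae_of_all _ (fun ω => ?_))
          rw [norm_mul, Real.norm_of_nonneg (poissonKernel_nonneg hν.le x ω)]
          exact mul_le_mul_of_nonneg_left (hM ω) (poissonKernel_nonneg hν.le x ω)
      _ = Real.pi * M := by rw [integral_mul_const, integral_poissonKernel hν x]
  have hgm : ∀ ν : ℝ, 0 < ν →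
      AEStronglyMeasurable (fun x : ℝ => ∫ ω, ν / ((x - ω) ^ 2 + ν ^ 2) * φ ω) μ := by
    intro ν hν
    have hc : Continuous (fun p : ℝ × ℝ => ν / ((p.1 - p.2) ^ 2 + ν ^ 2) * φ p.2) :=
      (continuous_const.div (by fun_prop) (fun p => by positivity)).mul (hφc.comp continuous_snd)
    exact (hc.stronglyMeasurable.integral_prod_right').aestronglyMeasurable
  -- (b) `∫ g_ν dμ → π ∫ φ dμ`
  have hlim1 : Tendsto (fun ν : ℝ => ∫ x, (∫ ω, ν / ((x - ω) ^ 2 + ν ^ 2) * φ ω) ∂μ) (𝓝[>] 0)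
      (𝓝 (∫ x, Real.pi * φ x ∂μ)) := by
    refine tendsto_integral_filter_of_dominated_convergence (fun _ => Real.pi * M) ?_ ?_
      (integrable_const _) ?_
    · filter_upwards [self_mem_nhdsWithin] with ν hν using hgm ν hν
    · filter_upwards [self_mem_nhdsWithin] with ν hν using ae_of_all _ (hgb ν hν)
    · exact ae_of_all _ (fun x => tendsto_poisson_integral hφc hφs x)
  -- (c) Fubini, for `ν > 0`
  have hfub : ∀ ν : ℝ, 0 < ν →
      ∫ ω, φ ω * (∫ x, ν / ((x - ω) ^ 2 + ν ^ 2) ∂μ) =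
        ∫ x, (∫ ω, ν / ((x - ω) ^ 2 + ν ^ 2) * φ ω) ∂μ := by
    intro ν hν
    have hFc : Continuous
        (Function.uncurry fun (ω x : ℝ) => φ ω * (ν / ((x - ω) ^ 2 + ν ^ 2))) :=
      continuous_poisson_integrand hφc hν
    have hle : ∀ x ω : ℝ, ‖φ ω * (ν / ((x - ω) ^ 2 + ν ^ 2))‖ ≤ ν / ((x - ω) ^ 2 + ν ^ 2) * M := by
      intro x ω
      rw [norm_mul, Real.norm_of_nonneg (poissonKernel_nonneg hν.le x ω), mul_comm]
      exact mul_le_mul_of_nonneg_left (hM ω) (poissonKernel_nonneg hν.le x ω)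
    have hint : Integrable (Function.uncurry fun (ω x : ℝ) => φ ω * (ν / ((x - ω) ^ 2 + ν ^ 2)))
        ((volume : Measure ℝ).prod μ) := by
      rw [integrable_prod_iff' hFc.aestronglyMeasurable]
      constructor
      · refine ae_of_all _ (fun x => ?_)
        exact ((integrable_poissonKernel hν x).mul_const M).mono'
          (hFc.comp (Continuous.prodMk_left x)).aestronglyMeasurable (ae_of_all _ (fun ω => hle x ω))
      · have h1 : AEStronglyMeasurable (fun p : ℝ × ℝ =>
            ‖Function.uncurry (fun (ω x : ℝ) => φ ω * (ν / ((x - ω) ^ 2 + ν ^ 2))) (p.2, p.1)‖)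
            (μ.prod volume) :=
          (hFc.comp (continuous_snd.prodMk continuous_fst)).norm.aestronglyMeasurable
        refine (integrable_const (Real.pi * M)).mono' h1.integral_prod_right'
          (ae_of_all _ (fun x => ?_))
        rw [Real.norm_of_nonneg (integral_nonneg (fun ω => norm_nonneg _))]
        calc ∫ ω, ‖Function.uncurry (fun (ω x : ℝ) => φ ω * (ν / ((x - ω) ^ 2 + ν ^ 2))) (ω, x)‖
            ≤ ∫ ω, ν / ((x - ω) ^ 2 + ν ^ 2) * M :=
              integral_mono_of_nonneg (ae_of_all _ (fun ω => norm_nonneg _))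
                ((integrable_poissonKernel hν x).mul_const M) (ae_of_all _ (fun ω => hle x ω))
          _ = Real.pi * M := by rw [integral_mul_const, integral_poissonKernel hν x]
    calc ∫ ω, φ ω * (∫ x, ν / ((x - ω) ^ 2 + ν ^ 2) ∂μ)
        = ∫ ω, ∫ x, φ ω * (ν / ((x - ω) ^ 2 + ν ^ 2)) ∂μ :=
          integral_congr_ae (ae_of_all _ (fun ω => (integral_const_mul _ _).symm))
      _ = ∫ x, ∫ ω, φ ω * (ν / ((x - ω) ^ 2 + ν ^ 2)) ∂volume ∂μ := integral_integral_swap hint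
      _ = ∫ x, (∫ ω, ν / ((x - ω) ^ 2 + ν ^ 2) * φ ω) ∂μ := by
          refine integral_congr_ae (ae_of_all _ (fun x => ?_))
          exact integral_congr_ae (ae_of_all _ (fun ω => mul_comm _ _))
  -- (d) `∫ φ F_ν → ∫ φ h`
  have hlim2 : Tendsto (fun ν : ℝ => ∫ ω, φ ω * (∫ x, ν / ((x - ω) ^ 2 + ν ^ 2) ∂μ)) (𝓝[>] 0)
      (𝓝 (∫ ω, φ ω * h ω)) := by
    have hIcc : IntegrableOn (fun ω => M * (‖h ω‖ + 1)) (Icc (-δ) δ) :=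
      (continuousOn_const.mul (hh.norm.add continuousOn_const)).integrableOn_Icc
    refine tendsto_integral_filter_of_dominated_convergence
      (fun ω => (Icc (-δ) δ).indicator (fun ω => M * (‖h ω‖ + 1)) ω) ?_ ?_
      ((integrable_indicator_iff measurableSet_Icc).2 hIcc) ?_
    · filter_upwards [self_mem_nhdsWithin] with ν hν
      have hν' : (0:ℝ) < ν := hν
      have hc : Continuous (fun p : ℝ × ℝ => ν / ((p.2 - p.1) ^ 2 + ν ^ 2)) :=
        continuous_const.div (by fun_prop) (fun p => by positivity)
      exact hφc.aestronglyMeasurable.mul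
        (hc.stronglyMeasurable.integral_prod_right').aestronglyMeasurable
    · filter_upwards [Metric.tendstoUniformlyOn_iff.1 hunif 1 one_pos] with ν hν
      refine ae_of_all _ (fun ω => ?_)
      by_cases hω : ω ∈ Icc (-δ) δ
      · rw [indicator_of_mem hω, norm_mul]
        have h1 := hν ω hω
        rw [dist_comm, dist_eq_norm] at h1
        have h2 : ‖∫ x, ν / ((x - ω) ^ 2 + ν ^ 2) ∂μ‖ ≤ ‖h ω‖ + 1 := by
          linarith [norm_le_norm_add_norm_sub' (∫ x, ν / ((x - ω) ^ 2 + ν ^ 2) ∂μ) (h ω)]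
        exact mul_le_mul (hM ω) h2 (norm_nonneg _) hM0
      · simp only [indicator_of_notMem hω, hφ0 ω hω, zero_mul, norm_zero, le_refl]
    · refine ae_of_all _ (fun ω => ?_)
      by_cases hω : ω ∈ Icc (-δ) δ
      · exact (hunif.tendsto_at hω).const_mul (φ ω)
      · simpa only [hφ0 ω hω, zero_mul] using tendsto_const_nhds
  -- (e) conclusion: the two limits coincide
  have heq : (fun ν : ℝ => ∫ x, (∫ ω, ν / ((x - ω) ^ 2 + ν ^ 2) * φ ω) ∂μ) =ᶠ[𝓝[>] 0]
      (fun ν : ℝ => ∫ ω, φ ω * (∫ x, ν / ((x - ω) ^ 2 + ν ^ 2) ∂μ)) := by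
    filter_upwards [self_mem_nhdsWithin] with ν hν using (hfub ν hν).symm
  have huniq := tendsto_nhds_unique (hlim1.congr' heq) hlim2
  rwa [integral_const_mul] at huniq

/-- **Density on the window.** If `μ` is finite, `h` is continuous on `[-δ, δ]`, non-negative on
`(-δ, δ)`, and `π ∫ φ dμ = ∫ φ h` for all continuous compactly supported `φ` vanishing off `[-δ, δ]`,
then `μ|_(−δ,δ) = (h/π) dω|_(−δ,δ)` (test against `g·ρ` with the cutoff `ρ = max(δ-|·|, 0)`, identify
the finite measures `ρ dμ = ρ h/π dω`, divide by `ρ`). [folklore] -/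
theorem restrict_Ioo_eq_withDensity_of_forall_integral (μ : Measure ℝ) [IsFiniteMeasure μ] {δ : ℝ}
    {h : ℝ → ℝ} (hh : ContinuousOn h (Icc (-δ) δ)) (hh0 : ∀ ω ∈ Ioo (-δ) δ, 0 ≤ h ω)
    (hid : ∀ φ : ℝ → ℝ, Continuous φ → HasCompactSupport φ → (∀ ω, ω ∉ Icc (-δ) δ → φ ω = 0) →
      Real.pi * ∫ x, φ x ∂μ = ∫ ω, φ ω * h ω) :
    μ.restrict (Ioo (-δ) δ) =
      (volume.restrict (Ioo (-δ) δ)).withDensity (fun ω => ENNReal.ofReal (h ω / Real.pi)) := by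
  obtain ⟨ρ, hρc, hρ0, hρle, hρpos, hρzero⟩ := exists_window_cutoff δ
  have hρzero' : ∀ x, x ∉ Icc (-δ) δ → ρ x = 0 :=
    fun x hx => hρzero x (fun h' => hx (Ioo_subset_Icc_self h'))
  have hρs : HasCompactSupport ρ := HasCompactSupport.intro (K := Icc (-δ) δ) isCompact_Icc hρzero'
  have hr : Measurable (fun x => ENNReal.ofReal (ρ x)) := hρc.measurable.ennreal_ofReal
  -- the density `q = ρ h / π`
  obtain ⟨q, hqdef⟩ : ∃ q : ℝ → ℝ, q = fun x => ρ x * (h x / Real.pi) := ⟨_, rfl⟩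
  have hq0 : ∀ x, 0 ≤ q x := by
    intro x
    rw [hqdef]
    by_cases hx : x ∈ Ioo (-δ) δ
    · exact mul_nonneg (hρ0 x) (div_nonneg (hh0 x hx) Real.pi_pos.le)
    · simp only [hρzero x hx, zero_mul, le_refl]
  have hqi : Integrable q := by
    have hqon : ContinuousOn q (Icc (-δ) δ) := hqdef ▸ hρc.continuousOn.mul (hh.div_const _)
    have heq : q = (Icc (-δ) δ).indicator q := by
      funext x
      by_cases hx : x ∈ Icc (-δ) δ
      · rw [indicator_of_mem hx]
      · rw [indicator_of_notMem hx, hqdef]; simp only [hρzero' x hx, zero_mul]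
    rw [heq, integrable_indicator_iff measurableSet_Icc]
    exact hqon.integrableOn_Icc
  have hqm : AEMeasurable (fun x => ENNReal.ofReal (q x)) volume :=
    hqi.aestronglyMeasurable.aemeasurable.ennreal_ofReal
  -- the finite measures `ρ dμ` and `q dω` coincide
  have hρi : Integrable ρ μ := integrable_of_continuous_of_norm_le μ hρc hρle
  haveI h1fin : IsFiniteMeasure (μ.withDensity fun x => ENNReal.ofReal (ρ x)) :=
    isFiniteMeasure_withDensity_ofReal hρi.hasFiniteIntegral
  haveI h2fin : IsFiniteMeasure (volume.withDensity fun x => ENNReal.ofReal (q x)) :=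
    isFiniteMeasure_withDensity_ofReal hqi.hasFiniteIntegral
  have hm : (μ.withDensity fun x => ENNReal.ofReal (ρ x)) =
      volume.withDensity fun x => ENNReal.ofReal (q x) := by
    refine ext_of_forall_integral_eq_of_IsFiniteMeasure (fun g => ?_)
    have hgρc : Continuous (fun x => g x * ρ x) := g.continuous.mul hρc
    have hgρs : HasCompactSupport (fun x => g x * ρ x) := hρs.mul_left
    have hgρ0 : ∀ ω, ω ∉ Icc (-δ) δ → g ω * ρ ω = 0 := fun ω hω => by
      rw [hρzero' ω hω, mul_zero]
    have key : Real.pi * ∫ x, g x * ρ x ∂μ = ∫ ω, g ω * ρ ω * h ω := hid _ hgρc hgρs hgρ0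
    have lhs : ∫ x, g x ∂(μ.withDensity fun x => ENNReal.ofReal (ρ x)) = ∫ x, ρ x * g x ∂μ := by
      rw [integral_withDensity_eq_integral_toReal_smul₀ hr.aemeasurable
        (ae_of_all _ (fun x => ENNReal.ofReal_lt_top))]
      refine integral_congr_ae (ae_of_all _ (fun x => ?_))
      simp only [ENNReal.toReal_ofReal (hρ0 x), smul_eq_mul]
    have rhs : ∫ x, g x ∂(volume.withDensity fun x => ENNReal.ofReal (q x)) = ∫ x, q x * g x := by
      rw [integral_withDensity_eq_integral_toReal_smul₀ hqm
        (ae_of_all _ (fun x => ENNReal.ofReal_lt_top))]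
      refine integral_congr_ae (ae_of_all _ (fun x => ?_))
      simp only [ENNReal.toReal_ofReal (hq0 x), smul_eq_mul]
    rw [lhs, rhs]
    calc ∫ x, ρ x * g x ∂μ = Real.pi⁻¹ * (Real.pi * ∫ x, g x * ρ x ∂μ) := by
          rw [← mul_assoc, inv_mul_cancel₀ Real.pi_pos.ne', one_mul]
          exact integral_congr_ae (ae_of_all _ (fun x => mul_comm _ _))
      _ = Real.pi⁻¹ * ∫ ω, g ω * ρ ω * h ω := by rw [key]
      _ = ∫ x, q x * g x := by
          rw [← integral_const_mul]
          refine integral_congr_ae (ae_of_all _ (fun x => ?_))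
          simp only [hqdef]
          ring
  -- divide by `ρ` on the window
  have hprod1 : (Ioo (-δ) δ).indicator (1 : ℝ → ℝ≥0∞) =
      (fun x => ENNReal.ofReal (ρ x)) * fun x => (ENNReal.ofReal (ρ x))⁻¹ := by
    funext x
    simp only [Pi.mul_apply]
    by_cases hx : x ∈ Ioo (-δ) δ
    · rw [indicator_of_mem hx, Pi.one_apply, ENNReal.mul_inv_cancel
        (ENNReal.ofReal_pos.2 (hρpos x hx)).ne' ENNReal.ofReal_ne_top]
    · rw [indicator_of_notMem hx, hρzero x hx, ENNReal.ofReal_zero, zero_mul]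
  have hprod2 : ((fun x => ENNReal.ofReal (q x)) * fun x => (ENNReal.ofReal (ρ x))⁻¹) =
      (Ioo (-δ) δ).indicator (fun ω => ENNReal.ofReal (h ω / Real.pi)) := by
    funext x
    simp only [Pi.mul_apply, hqdef]
    by_cases hx : x ∈ Ioo (-δ) δ
    · rw [indicator_of_mem hx, ENNReal.ofReal_mul (hρ0 x), mul_comm (ENNReal.ofReal (ρ x)) _,
        mul_assoc, ENNReal.mul_inv_cancel (ENNReal.ofReal_pos.2 (hρpos x hx)).ne'
        ENNReal.ofReal_ne_top, mul_one]
    · rw [indicator_of_notMem hx, hρzero x hx, zero_mul, ENNReal.ofReal_zero, zero_mul]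
  calc μ.restrict (Ioo (-δ) δ) = μ.withDensity ((Ioo (-δ) δ).indicator 1) :=
        (withDensity_indicator_one measurableSet_Ioo).symm
    _ = (μ.withDensity fun x => ENNReal.ofReal (ρ x)).withDensity
          (fun x => (ENNReal.ofReal (ρ x))⁻¹) := by
        rw [hprod1]
        exact withDensity_mul μ hr hr.inv
    _ = (volume.withDensity fun x => ENNReal.ofReal (q x)).withDensity
          (fun x => (ENNReal.ofReal (ρ x))⁻¹) := by rw [hm]
    _ = volume.withDensity ((fun x => ENNReal.ofReal (q x)) * fun x => (ENNReal.ofReal (ρ x))⁻¹) :=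
        (withDensity_mul₀ hqm hr.inv.aemeasurable).symm
    _ = volume.withDensity ((Ioo (-δ) δ).indicator (fun ω => ENNReal.ofReal (h ω / Real.pi))) := by
        rw [hprod2]
    _ = (volume.restrict (Ioo (-δ) δ)).withDensity (fun ω => ENNReal.ofReal (h ω / Real.pi)) :=
        withDensity_indicator measurableSet_Ioo _

/-- **Stub S3 of line `separable-vertex-faddeev-pair-sector` (crux `MourreDissolution`,
item `stmt-AtomisticToContinuum-12594`): Poisson-window inversion.** If `σ` is a finite measure on
`ℝ` with cosine transform `C`, and the Abel–Poisson transforms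
`F_ν(ω) = ∫_{t>0} e^{-νt} cos(ωt) C(t) dt` converge uniformly on `[-δ, δ]` (`δ > 0`) as `ν ↓ 0` to a
function `h` continuous on `[-δ, δ]`, then the symmetrised measure `σ' = ½(σ + σ(-·))` is finite, has
cosine transform `C`, `h ≥ 0` on `(-δ, δ)`, and `σ'|_(−δ,δ)` is Lebesgue measure with density `h/π`
(Stieltjes–Perron / Fatou inversion for the Poisson kernel). [folklore] -/
theorem stub_poissonWindowInversion :
    ∀ (σ : MeasureTheory.Measure ℝ) (C : ℝ → ℝ) (δ : ℝ) (h : ℝ → ℝ),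
      MeasureTheory.IsFiniteMeasure σ → 0 < δ →
      (∀ t : ℝ, C t = MeasureTheory.integral σ (fun ω : ℝ => Real.cos (ω * t))) →
      ContinuousOn h (Set.Icc (-δ) δ) →
      TendstoUniformlyOn
        (fun (ν : ℝ) (ω : ℝ) => MeasureTheory.integral (MeasureTheory.volume.restrict (Set.Ioi (0:ℝ)))
          (fun t : ℝ => Real.exp (-(ν * t)) * Real.cos (ω * t) * C t))
        h (nhdsWithin (0:ℝ) (Set.Ioi 0)) (Set.Icc (-δ) δ) →
      ∃ σ' : MeasureTheory.Measure ℝ, MeasureTheory.IsFiniteMeasure σ' ∧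
        (∀ t : ℝ, C t = MeasureTheory.integral σ' (fun ω : ℝ => Real.cos (ω * t))) ∧
        (∀ ω ∈ Set.Ioo (-δ) δ, 0 ≤ h ω) ∧
        σ'.restrict (Set.Ioo (-δ) δ) =
          (MeasureTheory.volume.restrict (Set.Ioo (-δ) δ)).withDensity
            (fun ω => ENNReal.ofReal (h ω / Real.pi)) := by
  intro σ C δ h hσ _hδ hC hh hunif
  haveI : IsFiniteMeasure σ := hσ
  obtain ⟨σ', hσ'⟩ : ∃ σ' : Measure ℝ, σ' = (2⁻¹ : ℝ≥0) • (σ + σ.map (fun x : ℝ => -x)) :=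
    ⟨_, rfl⟩
  haveI hfin : IsFiniteMeasure σ' := by rw [hσ']; infer_instance
  have hcos1 : ∀ a : ℝ, ‖Real.cos a‖ ≤ 1 := fun a => by
    rw [Real.norm_eq_abs]; exact Real.abs_cos_le_one a
  -- (1) the symmetrisation has the same cosine transform
  have hC' : ∀ t : ℝ, C t = ∫ ω, Real.cos (ω * t) ∂σ' := by
    intro t
    rw [hσ', integral_symm σ (F := fun ω => Real.cos (ω * t)) (by fun_prop) (fun ω => hcos1 _)]
    simp only [neg_mul, Real.cos_neg]
    rw [← hC t]; ring
  -- (2) Poisson representation and transfer of the uniform convergence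
  have hG : ∀ ν : ℝ, 0 < ν → ∀ ω : ℝ,
      ∫ t in Ioi (0:ℝ), Real.exp (-(ν * t)) * Real.cos (ω * t) * C t =
        ∫ x, ν / ((x - ω) ^ 2 + ν ^ 2) ∂σ' := fun ν hν ω => by
    rw [hσ']; exact integral_exp_neg_mul_cos_mul_cosTransform σ hC hν ω
  have hunif' : TendstoUniformlyOn (fun (ν : ℝ) (ω : ℝ) => ∫ x, ν / ((x - ω) ^ 2 + ν ^ 2) ∂σ') h
      (𝓝[>] 0) (Icc (-δ) δ) := by
    refine hunif.congr ?_
    filter_upwards [self_mem_nhdsWithin] with ν hν using fun ω _ => hG ν hν ω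
  -- (3) `h ≥ 0` on the closed window, as a pointwise limit of Poisson integrals
  have hpos : ∀ ω ∈ Icc (-δ) δ, 0 ≤ h ω := by
    intro ω hω
    refine ge_of_tendsto (hunif'.tendsto_at hω) ?_
    filter_upwards [self_mem_nhdsWithin] with ν hν
    exact integral_nonneg (fun x => poissonKernel_nonneg (le_of_lt hν) x ω)
  have hpos' : ∀ ω ∈ Ioo (-δ) δ, 0 ≤ h ω := fun ω hω => hpos ω (Ioo_subset_Icc_self hω)
  exact ⟨σ', hfin, hC', hpos', restrict_Ioo_eq_withDensity_of_forall_integral σ' hh hpos'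
    (fun φ hφc hφs hφ0 => pi_mul_integral_eq_of_tendstoUniformlyOn σ' hh hunif' hφc hφs hφ0)⟩

end Summit.AtomisticToContinuum.FouriersLaw.Theorems.MourreDissolution

end
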